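import Mathlib
import HarnessLib
import Literature.Analysis.FluidPDE.SwirlTransportProofs
import Literature.Analysis.FluidPDE.PineauVicolAngularMean
import Literature.Analysis.FluidPDE.NSLocalLerayBackwardUniqueness
import Summits.NavierStokesRegularity.NavierStokesRegularity.Theorems.PoloidalWindowDoorPoloidalWindowRigidityVorticityTranslate
import Summits.NavierStokesRegularity.NavierStokesRegularity.Theorems.PoloidalWindowDoorPoloidalWindowRigidityVorticityAxisymmetricSlice

/-!
# Route `PoloidalWindowDoor`, crux `PoloidalWindowRigidity` (K2, stmt-NavierStokesRegularity-19708) — ANALYTIC GLUE II: an INFINITESIMAL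
# horizontal Killing symmetry of the vorticity on an OPEN SET of one slice settles the profile

Cell ns-regularity-ideate, seat ns-poloidal-K2-p1 gen 3 (K2 lead; helper `--supports` the crux).  Conjecture LRC′ (memo K2P1-LOCAL-NOTES §10; line
proposal «lrc-jet») delivers the symmetry of the vorticity only LOCALLY and INFINITESIMALLY: `L_K ω = 0` on an open set, `K` a horizontal Killing field
(a translation `e`, or the rotation field `J(x − c)` of a vertical axis).  Slices of the class are real-analytic, so (identity theorem) the Lie
derivative vanishes on the whole slice, and integrating the one-parameter group gives the GLOBAL symmetry used by the tree's one-slice strata: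

* (translations: ns-poloidal-K2-p3 g3 landed the one-slice statement `…LocalVorticitySymmetry.nonflatLiouville_of_local_curl_translation`
  while this file was written; its rotation statement `nonflatLiouville_of_local_curl_rotation` needs the infinitesimal symmetry on an open
  SPACE–TIME set because it ends in the all-slices fixed-axis stratum p461071.)
* `nonflatLiouville_of_rotOp_curl_eq_zero_on_open` — ONE SLICE suffices for rotations too: with `ω_c = curl (y ↦ v(s)(y + c))`, if
  `J ω_c(x) − Dω_c(x)[J x] = 0` on a non-empty open subset of ONE slice, then it vanishes on the whole slice (identity theorem; the
  generator splits as `J x = −x₁e₀ + x₀e₁`, so `x ↦ Dω_c(x)[Jx]` is analytic), `θ ↦ R_{−θ} ω_c(R_θ y)` is constant (Pineau–Vicol calculus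
  `hasDerivAt_rotZ_neg_comp_rotZ`), `ω_c` is axisymmetric, and this seat's ONE-SLICE any-axis stratum
  `…VorticityAxisymmetricSlice.nonflatLiouville_of_curl_axisymmetric_slice` (p513088) ends — moving axes included.

WHAT THIS IS NOT: not a claim about Navier–Stokes regularity, not LRC′ and not the residue — the local-to-global step of the transfer (line stub L2). [folklore]
-/

noncomputable section

-- the summit and its single sub-problem share the name (CONVENTIONS §1), as in every Theorems file
set_option linter.dupNamespace false

namespace Summit.NavierStokesRegularity.NavierStokesRegularity.Theorems.PoloidalWindowDoorPoloidalWindowRigidityKillingOpenSet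

open Set Function Filter Topology InnerProductSpace
open scoped RealInnerProductSpace InnerProductSpace
open Literature.Analysis Literature.Analysis.FluidPDE
open Summit.NavierStokesRegularity.NavierStokesRegularity.Theorems.LocalSineTubeDoorProfileAlignedWindowRigidityAncient
open Summit.NavierStokesRegularity.NavierStokesRegularity.Theorems.PoloidalWindowDoorPoloidalWindowRigidityFlat
open Summit.NavierStokesRegularity.NavierStokesRegularity.Theorems.PoloidalWindowDoorPoloidalWindowRigidityAxisymmetric
open Summit.NavierStokesRegularity.NavierStokesRegularity.Theorems.PoloidalWindowDoorPoloidalWindowRigidityVorticityTranslate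
open Summit.NavierStokesRegularity.NavierStokesRegularity.Theorems.PoloidalWindowDoorPoloidalWindowRigidityVorticityAxisymmetricSlice

variable {C : ℝ} {v : ℝ → EuclideanSpace ℝ (Fin 3) → EuclideanSpace ℝ (Fin 3)}

/-! ### Rotations about a vertical axis -/

/-- **Infinitesimal axisymmetry of the vorticity about the axis `c + ℝe₃` on an open set of one slice ⇒ not backward-singular.**
With `ω_c = curl (y ↦ v(s)(y + c))`: if `J ω_c(x) = Dω_c(x)[J x]` for `x` in a non-empty open set, then `(0,0)` is not a backward singular point. -/
theorem nonflatLiouville_of_rotOp_curl_eq_zero_on_open (hrate : HasTypeITimeDecay C v)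
    (hcont : ContinuousOn (uncurry v) (Iio (0 : ℝ) ×ˢ univ))
    (hmild : ∀ s t : ℝ, s < t → t < 0 → ∀ x,
      v t x = UnboundedOperators.heatExtension (v s) (t - s) x - oseenDuhamel 1 s v v t x)
    (hdiv : ∀ t < 0, VectorCalculus.IsDivFree (v t))
    (hpol : ∀ s < 0, ∀ y, ⟪curl (v s) y, EuclideanSpace.single 2 1⟫_ℝ = 0)
    {s : ℝ} (hs : s < 0) (c : EuclideanSpace ℝ (Fin 3))
    {S : Set (EuclideanSpace ℝ (Fin 3))} (hS : IsOpen S) (hne : S.Nonempty)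
    (h : ∀ x ∈ S, rotGen (curl (fun y => v s (y + c)) x) - fderiv ℝ (curl (fun y => v s (y + c))) x (rotGen x) = 0) :
    ¬ IsBackwardSingularPoint v 0 := by
  obtain ⟨hrate', hcont', hmild', hdiv'⟩ := class_translate c hrate hcont hmild hdiv
  have hbdd' := bdd_of_hasTypeITimeDecay hrate'
  have hA : AnalyticOnNhd ℝ ((fun t y => v t (y + c)) s) univ := analyticOnNhd_slice hcont' hbdd' hmild' hs
  set ω : EuclideanSpace ℝ (Fin 3) → EuclideanSpace ℝ (Fin 3) := curl (fun y => v s (y + c)) with hωdef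
  have hω : AnalyticOnNhd ℝ ω univ := analyticOnNhd_curl hA
  have hω1 : ContDiff ℝ 1 ω := hω.contDiff
  -- the rotation operator `𝓡ω(x) = J ω(x) − Dω(x)[J x]` is analytic and vanishes on `S`, hence everywhere
  set G : EuclideanSpace ℝ (Fin 3) → EuclideanSpace ℝ (Fin 3) := fun x => rotGen (ω x) - fderiv ℝ ω x (rotGen x) with hG
  -- the generator splits along the horizontal basis vectors: `J x = −x₁ e₀ + x₀ e₁`
  have hJ : ∀ x : EuclideanSpace ℝ (Fin 3), rotGen x =
      (-(x 1)) • (EuclideanSpace.single 0 (1 : ℝ)) + (x 0) • (EuclideanSpace.single 1 (1 : ℝ)) := fun x => by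
    ext i; fin_cases i <;> simp [rotGen]
  -- analytic building blocks: directional derivatives `x ↦ Dω(x)[w]` and coordinates `x ↦ x k`
  have hDan : ∀ w : EuclideanSpace ℝ (Fin 3), AnalyticOnNhd ℝ (fun x => fderiv ℝ ω x w) univ := fun w => by
    have h1 := (ContinuousLinearMap.apply ℝ (EuclideanSpace ℝ (Fin 3)) w).comp_analyticOnNhd (AnalyticOnNhd.fderiv hω)
    exact AnalyticOnNhd.congr isOpen_univ h1 (fun y _ => by simp [Function.comp])
  have hXan : ∀ k : Fin 3, AnalyticOnNhd ℝ (fun x : EuclideanSpace ℝ (Fin 3) => x k) univ := fun k => by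
    have h1 := (innerSL ℝ (EuclideanSpace.single k (1 : ℝ))).analyticOnNhd univ
    exact AnalyticOnNhd.congr isOpen_univ h1 (fun x _ => by simp [EuclideanSpace.inner_single_left])
  have hGan : AnalyticOnNhd ℝ G univ := by
    have h1 : AnalyticOnNhd ℝ (fun x => rotGenL (ω x)) univ := rotGenL.comp_analyticOnNhd hω
    have h2 : AnalyticOnNhd ℝ (fun x : EuclideanSpace ℝ (Fin 3) =>
        (-(x 1)) • fderiv ℝ ω x (EuclideanSpace.single 0 (1 : ℝ)) + (x 0) • fderiv ℝ ω x (EuclideanSpace.single 1 (1 : ℝ))) univ :=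
      (((hXan 1).neg).smul (hDan _)).add ((hXan 0).smul (hDan _))
    refine AnalyticOnNhd.congr isOpen_univ (h1.sub h2) (fun x _ => ?_)
    simp only [hG, rotGenL_apply, Pi.sub_apply]
    rw [hJ x, map_add, map_smul, map_smul]
  obtain ⟨x₀, hx₀⟩ := hne
  have hev : G =ᶠ[𝓝 x₀] 0 := by
    filter_upwards [hS.mem_nhds hx₀] with z hz
    simp only [hG, h z hz, Pi.zero_apply]
  have hG0 : ∀ x, G x = 0 := fun x =>
    hGan.eqOn_zero_of_preconnected_of_eventuallyEq_zero isPreconnected_univ (mem_univ x₀) hev (mem_univ x)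
  -- integrate the rotation group: `θ ↦ R_{−θ} ω (R_θ y)` is constant
  have hax : IsAxisymmetric ω := by
    intro θ y
    have hderiv : ∀ t, HasDerivAt (fun t => rotZ (-t) (ω (rotZ t y))) (0 : EuclideanSpace ℝ (Fin 3)) t := by
      intro t
      have hd := hasDerivAt_rotZ_neg_comp_rotZ hω1 y t
      have hz : -(rotZ (-t) (rotGen (ω (rotZ t y)) - fderiv ℝ ω (rotZ t y) (rotGen (rotZ t y)))) = 0 := by
        have h0 : rotGen (ω (rotZ t y)) - fderiv ℝ ω (rotZ t y) (rotGen (rotZ t y)) = 0 := hG0 (rotZ t y)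
        rw [h0, ← rotZL_apply, map_zero, neg_zero]
      rwa [hz] at hd
    have hconst := is_const_of_deriv_eq_zero (fun t => (hderiv t).differentiableAt) (fun t => (hderiv t).deriv) θ 0
    -- `R_{−θ} ω(R_θ y) = ω y`
    have h0 : rotZ (-(0 : ℝ)) (ω (rotZ 0 y)) = ω y := by simp [rotZ_zero]
    rw [h0] at hconst
    have h1 := congrArg (rotZ θ) hconst
    rwa [← rotZ_add, add_neg_cancel, rotZ_zero] at h1
  exact nonflatLiouville_of_curl_axisymmetric_slice hrate hcont hmild hdiv hpol hs c hax

end Summit.NavierStokesRegularity.NavierStokesRegularity.Theorems.PoloidalWindowDoorPoloidalWindowRigidityKillingOpenSet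

end
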